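import Summits.Ventures.HodgeRepro2.HostAPI.Carriers.AlgebraicGeometry.Motives.WeilCohomology

/-!
# T6A2WeilRing — the even-degree cohomology ring of a host Weil cohomology

Cell pub-hodge-repro2, Tier 6 (README §10), seat t6-p2 (A2 host side). For `W : WeilCohomology k ℚ`
(the host's `HostAPI.Carriers.AlgebraicGeometry.Motives.WeilCohomology`) and a smooth projective
`X` (bundled as `SPVar k` = a scheme with its dimension and the smoothness proof), the even-degree pieces
`W.obj X (2 i)` form a graded-commutative `ℚ`-algebra under the cup product: `EvenRing W P := ⨁ i, W.obj P.X (2 i)`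
(`DirectSum.commRing` / `DirectSum.algebra` from a `GCommRing` + `GAlgebra ℚ` built from `W.cup`, `W.one`
and the host's fields `cup_assoc`, `cup_comm` (the Koszul sign is `+1` on even degrees), `one_cup`).
The pull-back along a morphism is a `ℚ`-algebra homomorphism (`map_cup`, `map_one`), the trace on the top
degree is the integral. This is the `H` / `pull` / `integral` part of the instantiation of `T6A2Gysin.CycleTheory`
on the host (STATUS l. 5153). No `sorry`; standard axioms.
§8(d): uses an L-value-free non-vanishing device: NO.
-/

noncomputable section

namespace Summit.Ventures.HodgeRepro2.T6.WeilInst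

open HostAPI.Carriers.AlgebraicGeometry.Motives CategoryTheory Opposite
open scoped DirectSum

universe u

variable {k : Type u} [Field k]

/-- A smooth projective variety over `k` with its dimension. -/
structure SPVar (k : Type u) [Field k] where
  /-- the scheme -/
  X : SchemeOver k
  /-- its dimension -/
  n : ℕ
  /-- smooth and projective of dimension `n` -/
  smooth : IsSmoothProjective n X

variable (W : WeilCohomology k ℚ)

/-- The even-degree pieces `H^{2i}(X)`. -/
abbrev Ev (X : SchemeOver k) (i : ℕ) : Type u := W.obj X (2 * i)

/-- `W.cup` is independent of the proof of the degree equation, up to the cast. -/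
theorem cup_heq {X : SchemeOver k} {i j m m' : ℕ} (h : i + j = m) (h' : i + j = m')
    (a : W.obj X i) (b : W.obj X j) : HEq (W.cup h a b) (W.cup h' a b) := by
  subst h; subst h'; rfl

variable (P : SPVar k)

/-- the graded multiplication -/
instance instGMul : GradedMonoid.GMul (Ev W P.X) :=
  ⟨fun {i j} a b => W.cup (by omega : 2 * i + 2 * j = 2 * (i + j)) a b⟩

/-- the graded unit -/
instance instGOne : GradedMonoid.GOne (Ev W P.X) := ⟨W.one P.X⟩

/-- the graded multiplication, unfolded -/
theorem gmul_def {i j : ℕ} (a : Ev W P.X i) (b : Ev W P.X j) :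
    GradedMonoid.GMul.mul a b = W.cup (by omega : 2 * i + 2 * j = 2 * (i + j)) a b := rfl

/-- the graded unit, unfolded -/
theorem gone_def : (GradedMonoid.GOne.one : Ev W P.X 0) = W.one P.X := rfl

/-- the Koszul sign on even degrees is `+1` -/
theorem cup_comm_even {i j m : ℕ} (h : 2 * i + 2 * j = m) (h' : 2 * j + 2 * i = m)
    (a : Ev W P.X i) (b : Ev W P.X j) : W.cup h a b = W.cup h' b a := by
  rw [W.cup_comm P.smooth h h' a b]
  have : ((2 * i : ℕ) * (2 * j : ℕ) : ℤ).negOnePow = 1 := by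
    apply Int.negOnePow_even
    exact ⟨(i * (2 * j) : ℕ), by push_cast; ring⟩
  rw [this]
  simp

/-- the even-degree graded commutative ring structure -/
instance instGCommRing : DirectSum.GCommRing (Ev W P.X) where
  mul_zero {i j} a := by
    show W.cup _ a (0 : Ev W P.X j) = 0
    simp
  zero_mul {i j} b := by
    show W.cup _ (0 : Ev W P.X i) b = 0
    simp
  mul_add {i j} a b c := by
    show W.cup _ a (b + c) = W.cup _ a b + W.cup _ a c
    simp
  add_mul {i j} a b c := by
    show W.cup _ (a + b) c = W.cup _ a c + W.cup _ b c
    simp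
  one_mul := by
    rintro ⟨i, a⟩
    refine Sigma.ext (by simp) ?_
    show HEq (W.cup _ (W.one P.X) a) a
    exact (cup_heq W _ (by omega : 0 + 2 * i = 2 * i) _ _).trans
      (heq_of_eq (W.one_cup P.smooth _ a))
  mul_one := by
    rintro ⟨i, a⟩
    refine Sigma.ext (by simp) ?_
    show HEq (W.cup _ a (W.one P.X)) a
    rw [cup_comm_even W P _ (by omega : 2 * 0 + 2 * i = 2 * (i + 0))]
    exact (cup_heq W _ (by omega : 0 + 2 * i = 2 * i) _ _).trans
      (heq_of_eq (W.one_cup P.smooth _ a))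
  mul_assoc := by
    rintro ⟨i, a⟩ ⟨j, b⟩ ⟨l, c⟩
    refine Sigma.ext (by simp [add_assoc]) ?_
    show HEq (W.cup _ (W.cup _ a b) c) (W.cup _ a (W.cup _ b c))
    refine (cup_heq W _ (by omega : 2 * (i + j) + 2 * l = 2 * (i + (j + l))) _ _).trans ?_
    exact heq_of_eq (W.cup_assoc P.smooth _ _ _ _ a b c)
  natCast n := n • W.one P.X
  natCast_zero := zero_smul _ _
  natCast_succ n := succ_nsmul _ _
  intCast n := n • W.one P.X
  intCast_ofNat n := natCast_zsmul _ _
  intCast_negSucc_ofNat n := negSucc_zsmul _ _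
  mul_comm := by
    rintro ⟨i, a⟩ ⟨j, b⟩
    refine Sigma.ext (by simp [add_comm]) ?_
    show HEq (W.cup _ a b) (W.cup _ b a)
    rw [cup_comm_even W P _ (by omega : 2 * j + 2 * i = 2 * (i + j))]
    exact cup_heq W _ _ _ _

/-- the `ℚ`-algebra structure -/
instance instGAlgebra : DirectSum.GAlgebra ℚ (Ev W P.X) where
  toFun :=
    { toFun := fun r => r • W.one P.X
      map_zero' := zero_smul _ _
      map_add' := fun r s => add_smul r s _ }
  map_one := one_smul _ _
  map_mul r s := by
    refine Sigma.ext rfl ?_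
    apply heq_of_eq
    show (r * s) • W.one P.X =
      W.cup (show (0 : ℕ) + 0 = 0 from rfl) (r • W.one P.X) (s • W.one P.X)
    rw [map_smul, LinearMap.map_smul₂, W.one_cup P.smooth rfl (W.one P.X), smul_smul, mul_comm]
  commutes r := by
    rintro ⟨i, a⟩
    refine Sigma.ext (by simp [add_comm]) ?_
    show HEq (W.cup _ (r • W.one P.X) a) (W.cup _ a (r • W.one P.X))
    exact (heq_of_eq (cup_comm_even W P _ (by omega : 2 * i + 2 * 0 = 2 * (0 + i)) _ _)).trans
      (cup_heq W _ (by omega : 2 * i + 2 * 0 = 2 * (i + 0)) _ _)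
  smul_def r := by
    rintro ⟨i, a⟩
    refine Sigma.ext ?_ ?_
    · rw [GradedMonoid.fst_smul]
      show i = 0 + i
      simp
    · rw [GradedMonoid.snd_smul]
      show HEq (r • a) (W.cup _ (r • W.one P.X) a)
      refine HEq.trans ?_ (cup_heq W (by omega : 0 + 2 * i = 2 * i) (by omega : 0 + 2 * i = 2 * (0 + i)) _ _)
      apply heq_of_eq
      rw [LinearMap.map_smul₂, W.one_cup P.smooth _ a]

/-- THE EVEN-DEGREE COHOMOLOGY RING `H^{even}(X, ℚ) = ⨁_i H^{2i}(X)` of the host Weil cohomology. -/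
abbrev EvenRing : Type u := ⨁ i, Ev W P.X i

example : CommRing (EvenRing W P) := inferInstance
example : Algebra ℚ (EvenRing W P) := inferInstance

/-- the degree-`i` inclusion -/
abbrev ofDeg (i : ℕ) : Ev W P.X i →ₗ[ℚ] EvenRing W P := DirectSum.lof ℚ ℕ (Ev W P.X) i

/-- the product of two homogeneous elements is the cup product in the sum of the degrees -/
theorem ofDeg_mul_ofDeg {i j : ℕ} (a : Ev W P.X i) (b : Ev W P.X j) :
    ofDeg W P i a * ofDeg W P j b = ofDeg W P (i + j) (W.cup (by omega) a b) := by
  simp only [ofDeg, DirectSum.lof_eq_of]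
  exact DirectSum.of_mul_of _ _

/-- `1` is the host's `one` in degree `0` -/
theorem one_def : (1 : EvenRing W P) = ofDeg W P 0 (W.one P.X) := rfl

/-- The integral `∫_X : H^{even}(X) → ℚ` is the host's trace on the top degree `2 dim X`. -/
def integral : EvenRing W P →ₗ[ℚ] ℚ :=
  (W.trace P.X P.n).comp (DirectSum.component ℚ ℕ (Ev W P.X) P.n)

/-- the integral of a top-degree element is its trace -/
theorem integral_ofDeg_top (a : Ev W P.X P.n) : integral W P (ofDeg W P P.n a) = W.trace P.X P.n a := by
  simp [integral]

/-- the integral kills the homogeneous elements off the top degree -/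
theorem integral_ofDeg_of_ne {i : ℕ} (hi : i ≠ P.n) (a : Ev W P.X i) : integral W P (ofDeg W P i a) = 0 := by
  simp only [integral, ofDeg, LinearMap.comp_apply, DirectSum.component.of, dif_neg hi, map_zero]

section pull

variable {P} {Q : SPVar k} (f : P.X ⟶ Q.X)

/-- the pull-back `f^*` on the even-degree rings, as a `ℚ`-algebra homomorphism -/
def pull : EvenRing W Q →ₐ[ℚ] EvenRing W P :=
  AlgHom.ofLinearMap (DirectSum.lmap fun i => W.pullback f (2 * i))
    (by
      rw [one_def, DirectSum.lmap_lof, W.map_one P.smooth Q.smooth f]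
      rfl)
    (by
      intro x y
      induction x using DirectSum.induction_on with
      | zero => simp
      | of i a =>
        induction y using DirectSum.induction_on with
        | zero => simp
        | of j b =>
          rw [← DirectSum.lof_eq_of ℚ, ← DirectSum.lof_eq_of ℚ]
          change _ = DirectSum.lmap _ (ofDeg W Q i a) * DirectSum.lmap _ (ofDeg W Q j b)
          rw [ofDeg_mul_ofDeg, ofDeg, DirectSum.lmap_lof, DirectSum.lmap_lof, DirectSum.lmap_lof,
            ← ofDeg, ← ofDeg, ← ofDeg, ofDeg_mul_ofDeg, W.map_cup P.smooth Q.smooth f]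
        | add y z hy hz => rw [mul_add, map_add, hy, hz, map_add, mul_add]
      | add x z hx hz => rw [add_mul, map_add, hx, hz, map_add, add_mul])

/-- the pull-back of a homogeneous element is the host's `pullback` in that degree -/
theorem pull_ofDeg (i : ℕ) (a : Ev W Q.X i) : pull W f (ofDeg W Q i a) = ofDeg W P i (W.pullback f (2 * i) a) := by
  simp [pull, ofDeg, DirectSum.lmap_lof]

end pull

section pairing

/-- moving a cup product to an equal degree -/
theorem ofDeg_cup_eq {i j m : ℕ} (h : i + j = m) (a : Ev W P.X i) (b : Ev W P.X j) :
    ofDeg W P (i + j) (W.cup (by omega : 2 * i + 2 * j = 2 * (i + j)) a b) =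
      ofDeg W P m (W.cup (by omega : 2 * i + 2 * j = 2 * m) a b) := by
  subst h; rfl

/-- `integral (ofDeg i a * ofDeg j b)`: the trace of the cup product when `i + j = dim`, `0` otherwise. -/
theorem integral_ofDeg_mul_ofDeg {i j : ℕ} (a : Ev W P.X i) (b : Ev W P.X j) :
    integral W P (ofDeg W P i a * ofDeg W P j b) =
      if h : i + j = P.n then W.trace P.X P.n (W.cup (by omega : 2 * i + 2 * j = 2 * P.n) a b) else 0 := by
  rw [ofDeg_mul_ofDeg]
  split_ifs with h
  · rw [ofDeg_cup_eq W P h, integral_ofDeg_top]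
  · rw [integral_ofDeg_of_ne W P h]

/-- pieces above the dimension vanish -/
theorem ev_eq_zero_of_lt {i : ℕ} (hi : P.n < i) (a : Ev W P.X i) : a = 0 := by
  haveI := W.subsingleton_obj P.smooth (i := 2 * i) (by omega)
  exact Subsingleton.elim _ _

/-- every element is the sum of its components of degree `≤ dim` -/
theorem eq_sum_ofDeg (x : EvenRing W P) :
    x = ∑ i ∈ Finset.range (P.n + 1), ofDeg W P i (x i) := by
  classical
  conv_lhs => rw [← DirectSum.sum_support_of x]
  simp only [ofDeg, DirectSum.lof_eq_of]
  refine Finset.sum_subset ?_ ?_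
  · intro i hi
    rw [DFinsupp.mem_support_iff] at hi
    rw [Finset.mem_range]
    by_contra h
    exact hi (ev_eq_zero_of_lt W P (by omega) _)
  · intro i _ hi
    rw [DFinsupp.notMem_support_iff.1 hi, map_zero]

/-- THE GLOBAL PAIRING `⟨x, y⟩ = ∫_X x ∪ y` on the even-degree ring. -/
def pairing : EvenRing W P →ₗ[ℚ] EvenRing W P →ₗ[ℚ] ℚ :=
  (LinearMap.mul ℚ (EvenRing W P)).compr₂ (integral W P)

/-- the global pairing, unfolded -/
theorem pairing_apply (x y : EvenRing W P) : pairing W P x y = integral W P (x * y) := rfl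

/-- the global pairing is symmetric (the even ring is commutative) -/
theorem pairing_comm (x y : EvenRing W P) : pairing W P x y = pairing W P y x := by
  simp only [pairing_apply, mul_comm]

/-- the pairing of `x` with a homogeneous element only sees the complementary component of `x` -/
theorem pairing_ofDeg_right (x : EvenRing W P) {i j : ℕ} (hij : i + j = P.n) (b : Ev W P.X j) :
    pairing W P x (ofDeg W P j b) =
      W.trace P.X P.n (W.cup (by omega : 2 * i + 2 * j = 2 * P.n) (x i) b) := by
  classical
  rw [pairing_apply]
  conv_lhs => rw [eq_sum_ofDeg W P x]
  rw [Finset.sum_mul, map_sum]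
  rw [Finset.sum_eq_single i]
  · rw [integral_ofDeg_mul_ofDeg, dif_pos hij]
  · intro i' _ hi'
    rw [integral_ofDeg_mul_ofDeg, dif_neg (by omega)]
  · intro h
    exact absurd (Finset.mem_range.2 (by omega)) h

/-- the even-degree ring is finite-dimensional (`finite_obj` + the pieces above the dimension vanish) -/
instance instFinite : Module.Finite ℚ (EvenRing W P) := by
  classical
  haveI : ∀ i : Fin (P.n + 1), Module.Finite ℚ (Ev W P.X i) := fun i => W.finite_obj P.smooth _
  refine Module.Finite.of_surjective
    (∑ i : Fin (P.n + 1), (ofDeg W P i).comp (LinearMap.proj (R := ℚ) (φ := fun i : Fin (P.n + 1) => Ev W P.X i) i)) ?_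
  intro x
  refine ⟨fun i => x i, ?_⟩
  simp only [LinearMap.sum_apply, LinearMap.comp_apply, LinearMap.proj_apply]
  conv_rhs => rw [eq_sum_ofDeg W P x]
  exact Fin.sum_univ_eq_sum_range (fun i => ofDeg W P i (x i)) (P.n + 1)

/-- the global pairing is non-degenerate on the left (degree by degree, `isPerfPair_cupPairing`) -/
theorem pairing_injective : Function.Injective (pairing W P) := by
  classical
  rw [← LinearMap.ker_eq_bot, LinearMap.ker_eq_bot']
  intro x hx
  refine DFinsupp.ext fun i => ?_
  change x i = 0
  by_cases hi : P.n < i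
  · exact ev_eq_zero_of_lt W P hi _
  · rw [not_lt] at hi
    have hperf := W.isPerfPair_cupPairing P.smooth (2 * i) (2 * (P.n - i)) (by omega)
    refine hperf.bijective_left.injective ?_
    rw [map_zero]
    ext b
    have := congrArg (fun f => f (ofDeg W P (P.n - i) b)) hx
    simp only [LinearMap.zero_apply] at this
    rw [pairing_ofDeg_right W P x (by omega : i + (P.n - i) = P.n) b] at this
    simpa [PreWeilCohomology.cupPairing] using this

/-- the global pairing is perfect -/
instance instIsPerfPair : (pairing W P).IsPerfPair := by
  refine LinearMap.IsPerfPair.of_injective (pairing_injective W P) ?_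
  have : (pairing W P).flip = pairing W P :=
    LinearMap.ext fun x => LinearMap.ext fun y => pairing_comm W P y x
  rw [this]
  exact pairing_injective W P

end pairing

section pullLemmas

variable {P} {Q R : SPVar k}

/-- `(𝟙)^* = id` -/
theorem pull_id (x : EvenRing W P) : pull W (𝟙 P.X) x = x := by
  induction x using DirectSum.induction_on with
  | zero => simp
  | of i a =>
    rw [← DirectSum.lof_eq_of ℚ]
    change pull W (𝟙 P.X) (ofDeg W P i a) = ofDeg W P i a
    rw [pull_ofDeg, W.pullback_id]
    rfl
  | add x y hx hy => rw [map_add, hx, hy]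

/-- `(g ≫ h)^* = g^* ∘ h^*` -/
theorem pull_comp (g : P.X ⟶ Q.X) (h : Q.X ⟶ R.X) (x : EvenRing W R) :
    pull W (g ≫ h) x = pull W g (pull W h x) := by
  induction x using DirectSum.induction_on with
  | zero => simp
  | of i a =>
    rw [← DirectSum.lof_eq_of ℚ]
    change pull W (g ≫ h) (ofDeg W R i a) = pull W g (pull W h (ofDeg W R i a))
    rw [pull_ofDeg, pull_ofDeg, pull_ofDeg, W.pullback_comp]
    rfl
  | add x y hx hy => rw [map_add, hx, hy, map_add, map_add]

end pullLemmas

section push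

variable {P} {Q R : SPVar k} (g : P.X ⟶ Q.X)

/-- THE PUSH-FORWARD `g_* : H^{even}(X) → H^{even}(Y)` (the Gysin map): the adjoint of `g^*` under the global
pairings — Poincaré duality in the pairing form, `⟨g_* x, y⟩_Y = ⟨x, g^* y⟩_X`. -/
def push : EvenRing W P →ₗ[ℚ] EvenRing W Q :=
  (pairing W Q).toPerfPair.symm.toLinearMap ∘ₗ
    (LinearMap.lcomp ℚ ℚ (pull W g).toLinearMap) ∘ₗ pairing W P

/-- the defining identity of the push-forward -/
theorem pairing_push (x : EvenRing W P) (y : EvenRing W Q) :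
    pairing W Q (push W g x) y = pairing W P x (pull W g y) := by
  simp only [push, LinearMap.comp_apply, LinearEquiv.coe_coe]
  rw [← LinearMap.toPerfPair_apply (pairing W Q), LinearEquiv.apply_symm_apply]
  rfl

/-- the push-forward is determined by its pairings -/
theorem eq_of_pairing_eq {x x' : EvenRing W Q} (h : ∀ y, pairing W Q x y = pairing W Q x' y) : x = x' :=
  pairing_injective W Q (LinearMap.ext h)

/-- `(𝟙)_* = id` -/
theorem push_id (x : EvenRing W P) : push W (𝟙 P.X) x = x := by
  refine eq_of_pairing_eq W fun y => ?_
  rw [pairing_push, pull_id]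

/-- `(g ≫ h)_* = h_* ∘ g_*` -/
theorem push_comp (h : Q.X ⟶ R.X) (x : EvenRing W P) :
    push W (g ≫ h) x = push W h (push W g x) := by
  refine eq_of_pairing_eq W fun y => ?_
  rw [pairing_push, pairing_push, pairing_push, pull_comp]

/-- THE PROJECTION FORMULA `g_*(g^* α ∪ β) = α ∪ g_* β` (Lemma A4.1.1(ii) in the Weil vocabulary). -/
theorem push_pull_mul (α : EvenRing W Q) (β : EvenRing W P) :
    push W g (pull W g α * β) = α * push W g β := by
  refine eq_of_pairing_eq W fun y => ?_
  rw [pairing_push, pairing_apply, pairing_apply]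
  have h1 : pull W g α * β * pull W g y = β * pull W g (α * y) := by rw [map_mul]; ring
  have h2 : α * push W g β * y = push W g β * (α * y) := by ring
  rw [h1, h2, ← pairing_apply, ← pairing_apply, pairing_push]

/-- the push-forward preserves the integral (`ε_Y ∘ g_* = ε_X`) -/
theorem integral_push (x : EvenRing W P) : integral W Q (push W g x) = integral W P x := by
  have h := pairing_push W g x 1
  rw [pairing_apply, pairing_apply, mul_one, map_one, mul_one] at h
  exact h

end push

end Summit.Ventures.HodgeRepro2.T6.WeilInst

end
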